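import Summits.CriticalPhenomena.CardyFormulaZ2.Theorems.CardyFlipRussoVoronoiHubFromSmirnovGraphDefs
import Summits.CriticalPhenomena.CardyFormulaZ2.Theorems.CardyFlipRussoVoronoiHubFromSmirnovRestrictLocal

/-!
# Stub `stub_graphRestrict` of line `moebius-exact-delaunay-dilation-ward`
# (crux `VoronoiHubFromSmirnov`, stmt-CriticalPhenomena-6433) — brick of the S3b re-cut

**Locality of the homogeneous graph crossing event under restriction.**  For a compact `K'` inside
an open `W` and carrier families `K δ ⊆ K'` (arbitrary attachment families `B₀ δ`, `B₂ δ`), reading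
the graph crossing event `graphCross (K δ) (B₀ δ) (B₂ δ) δ` on the nuclei of the window
`{b | δ b ∈ W}` only (i.e. on the restricted pair `(c.1|_{W/δ}, c.2|_{W/δ})`) changes its
probability under the two-colour homogeneous Poisson law `lawBW volume` by `o(1)` as `δ → 0⁺`.

Proof.  `thickening d₀ K' ⊆ W` for some `d₀ > 0` (`IsCompact.exists_thickening_subset_open`) and
`K' ⊆ closedBall 0 ρ₀`.  Fix `δ > 0` and put `s := d₀ / (3δ)` (configuration scale).
* Deterministic core (`gr_isDelaunayPair_of_inter`): if every configuration point within `s` of a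
  chain nucleus `p` (`δ p ∈ K'`) has a black nucleus within `< s` (NO VOID), then an empty disc
  through `p` witnessing Delaunay adjacency with respect to the nuclei of the WINDOW has radius
  `r ≤ s` (otherwise the point at distance `s` from `p` towards its centre has a nucleus within
  `< s`, which lies inside the disc and inside the window — a contradiction), hence every nucleus
  inside it is within `2r ≤ 2s` of `p`, so inside the window: the disc is empty with respect to ALL
  nuclei.  The converse (adjacency w.r.t. all nuclei ⇒ w.r.t. the window) is anti-monotonicity
  (`IsDelaunayPair.anti`), and chain nuclei lie in `K δ ⊆ K' ⊆ W`.  So off the bad event "some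
  point of `closedBall 0 (ρ₀/δ + s)` has no black nucleus within `< s`" the restricted pair lies in
  the graph event iff the pair does (`gr_restrict_mem_graphCross_iff`).
* Probability: `|P(A') − P(A)| ≤ P(bad)` (`abs_measureReal_sub_le_of_iff`, no measurability), the
  bad event is a BLACK-marginal event (`rl_lawBW_real_fst`), i.e. a genuine Poisson probability
  (`isPoissonPointProcess_poissonLaw_volume`), bounded by the landed no-giant-cells estimate
  `poisson_voidNear_disc_le`: `≤ (36 ρ₀/d₀ + 13)² · exp (-π (d₀/(9δ))²) → 0`.

References: I. Benjamini, O. Schramm, *Conformal invariance of Voronoi percolation*, Comm. Math.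
Phys. 197 (1998) 75–107, §2 (the cluster event) and Lemma 5.5; B. Bollobás, O. Riordan,
*Percolation* (CUP 2006), Ch. 8 §8.2.  No new definitions; tree facts and Mathlib only.
-/

noncomputable section

namespace Summit.CriticalPhenomena.CardyFormulaZ2.Cruxes.VoronoiHubFromSmirnov.MoebiusExactDelaunayDilationWard

open scoped Topology ENNReal
open Filter Set MeasureTheory Metric
open Literature.Analysis.FunctionSpaces
open Literature.Probability.RandomPlanarGeometry
open Literature.Probability.LatticeModels (IsDelaunayPair)

/-! ### Deterministic core: small empty discs ignore far nuclei -/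

/-- **Empty discs deep inside the window are small on the no-void event.**  Let `τ` be a set of
nuclei and `V` a window containing the open `2s`-ball around `p`; assume every point within `s`
of `p` has a nucleus of `τ` within `< s`.  Then Delaunay adjacency of `p`, `q` with respect to the
nuclei `τ ∩ V` of the window implies adjacency with respect to all of `τ`: the witnessing empty
disc has radius `≤ s`, so any nucleus inside it would lie in the window. [folklore] -/
theorem gr_isDelaunayPair_of_inter {τ V : Set ℂ} {p q : ℂ} {s : ℝ} (hs : 0 ≤ s)
    (hV : ∀ w, dist w p < 2 * s → w ∈ V)
    (hNV : ∀ y, dist y p ≤ s → ∃ w ∈ τ, dist w y < s)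
    (h : IsDelaunayPair (τ ∩ V) p q) : IsDelaunayPair τ p q := by
  obtain ⟨z, r, hpz, hqz, hemp⟩ := h
  refine ⟨z, r, hpz, hqz, ?_⟩
  -- the empty disc is small: `r ≤ s`
  have hrs : r ≤ s := by
    by_contra hsr
    push Not at hsr
    obtain ⟨y, hpy, hyz⟩ := exists_dist_le_le (x := p) (z := z) hs (sub_nonneg.2 hsr.le)
      (by rw [hpz]; linarith)
    obtain ⟨w, hwτ, hwy⟩ := hNV y (by rwa [dist_comm] at hpy)
    have hwz : dist w z < r :=
      calc dist w z ≤ dist w y + dist y z := dist_triangle _ _ _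
        _ < s + (r - s) := add_lt_add_of_lt_of_le hwy hyz
        _ = r := by ring
    have hwp : dist w p < 2 * s :=
      calc dist w p ≤ dist w y + dist y p := dist_triangle _ _ _
        _ < s + s := add_lt_add_of_lt_of_le hwy (by rwa [dist_comm] at hpy)
        _ = 2 * s := by ring
    have h := hemp w ⟨hwτ, hV w hwp⟩
    linarith
  -- hence every nucleus inside it lies in the window
  intro w hw
  by_contra hlt
  push Not at hlt
  have hwp : dist w p < 2 * s :=
    calc dist w p ≤ dist w z + dist z p := dist_triangle _ _ _
      _ < r + r := add_lt_add_of_lt_of_le hlt (by rw [dist_comm, hpz])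
      _ ≤ 2 * s := by linarith
  exact absurd (hemp w ⟨hw, hV w hwp⟩) (not_le.2 hlt)

/-- Membership in a restricted configuration. [folklore] -/
theorem gr_mem_restrict_iff {V : Set ℂ} {d : PointConfig ℂ} {x : ℂ} :
    x ∈ PointConfig.restrict V d ↔ x ∈ d ∧ x ∈ V := Iff.rfl

/-- The nuclei (of both colours) of the restricted pair are the nuclei of the pair inside the
window. [folklore] -/
theorem gr_coe_restrict_union (V : Set ℂ) (c : PointConfig ℂ × PointConfig ℂ) :
    ((PointConfig.restrict V c.1 : PointConfig ℂ) : Set ℂ) ∪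
        ((PointConfig.restrict V c.2 : PointConfig ℂ) : Set ℂ) =
      ((c.1 : Set ℂ) ∪ (c.2 : Set ℂ)) ∩ V := by
  simp only [PointConfig.coe_eq_carrier, PointConfig.carrier_restrict,
    Set.union_inter_distrib_right]

/-- **Deterministic core.**  If the open `2s`-ball (configuration coordinates) around every `p`
with `δ p ∈ K'` lies in the window `{b | δ b ∈ W}`, `K ⊆ K' ⊆ W`, and every configuration point
within `s` of such a `p` has a BLACK nucleus within `< s` (no void), then the pair `c` restricted
to the window lies in the graph crossing event `graphCross K B₀ B₂ δ` iff `c` does. [folklore] -/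
theorem gr_restrict_mem_graphCross_iff {K K' W B₀ B₂ : Set ℂ} {δ s : ℝ} (hs : 0 ≤ s)
    (hKK' : K ⊆ K') (hK'W : K' ⊆ W)
    (h2s : ∀ p w : ℂ, (δ : ℂ) * p ∈ K' → dist w p < 2 * s → (δ : ℂ) * w ∈ W)
    (c : PointConfig ℂ × PointConfig ℂ)
    (hNV : ∀ p y : ℂ, (δ : ℂ) * p ∈ K' → dist y p ≤ s → ∃ w ∈ c.1, dist w y < s) :
    (PointConfig.restrict {b : ℂ | (δ : ℂ) * b ∈ W} c.1,
        PointConfig.restrict {b : ℂ | (δ : ℂ) * b ∈ W} c.2) ∈ graphCross K B₀ B₂ δ ↔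
      c ∈ graphCross K B₀ B₂ δ := by
  have hunion := gr_coe_restrict_union {b : ℂ | (δ : ℂ) * b ∈ W} c
  constructor
  · rintro ⟨N, p, hp1, hpK, hp0, hpN, hadj⟩
    refine ⟨N, p, fun i => (gr_mem_restrict_iff.1 (hp1 i)).1, hpK, hp0, hpN, fun i => ?_⟩
    have hi : (δ : ℂ) * p i.castSucc ∈ K' := hKK' (hpK _)
    have h : IsDelaunayPair (((c.1 : Set ℂ) ∪ (c.2 : Set ℂ)) ∩ {b : ℂ | (δ : ℂ) * b ∈ W})
        (p i.castSucc) (p i.succ) := by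
      rw [← hunion]
      exact hadj i
    exact gr_isDelaunayPair_of_inter hs (fun w hw => h2s _ w hi hw)
      (fun y hy => (hNV _ y hi hy).imp fun w hw => ⟨Or.inl hw.1, hw.2⟩) h
  · rintro ⟨N, p, hp1, hpK, hp0, hpN, hadj⟩
    refine ⟨N, p, fun i => gr_mem_restrict_iff.2 ⟨hp1 i, hK'W (hKK' (hpK i))⟩, hpK, hp0, hpN,
      fun i => ?_⟩
    have h : IsDelaunayPair (((c.1 : Set ℂ) ∪ (c.2 : Set ℂ)) ∩ {b : ℂ | (δ : ℂ) * b ∈ W})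
        (p i.castSucc) (p i.succ) := (hadj i).anti Set.inter_subset_left
    rw [← hunion] at h
    exact h

/-! ### Geometry at a fixed mesh -/

/-- A configuration point within `s` of a nucleus `p` with `δ p ∈ closedBall 0 ρ₀` lies in
`closedBall 0 (ρ₀/δ + s)`. [folklore] -/
theorem gr_mem_closedBall_of_dist_le {δ ρ₀ s : ℝ} (hδ : 0 < δ) {p y : ℂ}
    (hp : (δ : ℂ) * p ∈ closedBall (0 : ℂ) ρ₀) (hy : dist y p ≤ s) :
    y ∈ closedBall (0 : ℂ) (ρ₀ / δ + s) := by
  rw [mem_closedBall_zero_iff] at hp ⊢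
  rw [norm_mul, Complex.norm_of_nonneg hδ.le] at hp
  have hp' : ‖p‖ ≤ ρ₀ / δ := by
    rw [le_div_iff₀ hδ, mul_comm]
    exact hp
  calc ‖y‖ = ‖(y - p) + p‖ := by rw [sub_add_cancel]
    _ ≤ ‖y - p‖ + ‖p‖ := norm_add_le _ _
    _ = dist y p + ‖p‖ := by rw [dist_eq_norm]
    _ ≤ s + ρ₀ / δ := add_le_add hy hp'
    _ = ρ₀ / δ + s := add_comm _ _

/-! ### Probability: the bound at a fixed mesh -/

/-- **The bound at a fixed mesh.**  If `thickening d₀ K' ⊆ W`, `K' ⊆ closedBall 0 ρ₀`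
(`d₀ > 0`, `ρ₀ ≥ 0`) and `K ⊆ K'`, then for every `δ > 0` the probabilities of the restricted and
the unrestricted graph crossing events differ by at most
`(36 ρ₀ / d₀ + 13)² exp (-π (d₀ / (9δ))²)` (no black void of configuration radius `d₀/(3δ)`
over `closedBall 0 (ρ₀/δ + d₀/(3δ))`). [folklore] -/
theorem gr_abs_sub_le {K K' W B₀ B₂ : Set ℂ} {d₀ ρ₀ δ : ℝ} (hd₀ : 0 < d₀) (hρ₀ : 0 ≤ ρ₀)
    (hδ : 0 < δ) (hKK' : K ⊆ K') (hK'W : thickening d₀ K' ⊆ W)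
    (hK'ρ : K' ⊆ closedBall 0 ρ₀) :
    |(lawBW (volume : Measure ℂ)).real {c | (PointConfig.restrict {b : ℂ | (δ : ℂ) * b ∈ W} c.1,
        PointConfig.restrict {b : ℂ | (δ : ℂ) * b ∈ W} c.2) ∈ graphCross K B₀ B₂ δ}
      - (lawBW (volume : Measure ℂ)).real (graphCross K B₀ B₂ δ)|
      ≤ (36 * ρ₀ / d₀ + 13) ^ 2 * Real.exp (-(Real.pi * (d₀ / 9 * δ⁻¹) ^ 2)) := by
  haveI := isProbabilityMeasure_lawBW_volume
  have hδ0 : δ ≠ 0 := hδ.ne'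
  have hd0 : d₀ ≠ 0 := hd₀.ne'
  set s : ℝ := d₀ / (3 * δ) with hsdef
  have hs0 : 0 < s := by
    rw [hsdef]
    positivity
  set E : Set (PointConfig ℂ) :=
    {c₁ | ∃ z ∈ closedBall (0 : ℂ) (ρ₀ / δ + s), ∀ q ∈ c₁, s ≤ dist q z} with hE
  -- the window contains the `2s`-balls around the nuclei over `K'`
  have h2s : ∀ p w : ℂ, (δ : ℂ) * p ∈ K' → dist w p < 2 * s → (δ : ℂ) * w ∈ W := by
    intro p w hp hw
    refine hK'W (mem_thickening_iff.2 ⟨(δ : ℂ) * p, hp, ?_⟩)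
    have hdist : dist ((δ : ℂ) * w) ((δ : ℂ) * p) = δ * dist w p := by
      rw [dist_eq_norm, dist_eq_norm, ← mul_sub, norm_mul, Complex.norm_of_nonneg hδ.le]
    rw [hdist]
    have h23 : δ * (2 * s) = 2 / 3 * d₀ := by
      rw [hsdef]
      field_simp
    calc δ * dist w p < δ * (2 * s) := mul_lt_mul_of_pos_left hw hδ
      _ = 2 / 3 * d₀ := h23
      _ ≤ d₀ := by linarith
  -- off the bad event the two events agree
  have hgood : ∀ c : PointConfig ℂ × PointConfig ℂ,
      c ∉ {c : PointConfig ℂ × PointConfig ℂ | c.1 ∈ E} →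
      (c ∈ {c : PointConfig ℂ × PointConfig ℂ |
        (PointConfig.restrict {b : ℂ | (δ : ℂ) * b ∈ W} c.1,
          PointConfig.restrict {b : ℂ | (δ : ℂ) * b ∈ W} c.2) ∈ graphCross K B₀ B₂ δ} ↔
        c ∈ graphCross K B₀ B₂ δ) := by
    intro c hc
    simp only [mem_setOf_eq, hE] at hc
    push Not at hc
    exact gr_restrict_mem_graphCross_iff hs0.le hKK' ((self_subset_thickening hd₀ K').trans hK'W)
      h2s c fun p y hp hy => hc y (gr_mem_closedBall_of_dist_le hδ (hK'ρ hp) hy)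
  have h1 := abs_measureReal_sub_le_of_iff (lawBW volume) _ (graphCross K B₀ B₂ δ) _ hgood
  -- the bad event is a no-giant-cells event of a genuine Poisson process
  have h3 : s ≤ 3 * (ρ₀ / δ + s) := by
    have h := div_nonneg hρ₀ hδ.le
    linarith
  have hE_le : (poissonLaw (volume : Measure ℂ)).real E ≤
      (12 * (ρ₀ / δ + s) / s + 1) ^ 2 * Real.exp (-(Real.pi * (s / 3) ^ 2)) :=
    poisson_voidNear_disc_le isPoissonPointProcess_poissonLaw_volume (closedBall (0 : ℂ) (ρ₀ / δ + s))
      (ρ₀ / δ + s) s hs0 h3 Subset.rfl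
  have e1 : 12 * (ρ₀ / δ + s) / s + 1 = 36 * ρ₀ / d₀ + 13 := by
    rw [hsdef]
    field_simp
    ring
  have e2 : s / 3 = d₀ / 9 * δ⁻¹ := by
    rw [hsdef]
    field_simp
    ring
  rw [e1, e2] at hE_le
  calc |(lawBW (volume : Measure ℂ)).real {c | (PointConfig.restrict {b : ℂ | (δ : ℂ) * b ∈ W} c.1,
          PointConfig.restrict {b : ℂ | (δ : ℂ) * b ∈ W} c.2) ∈ graphCross K B₀ B₂ δ} -
          (lawBW (volume : Measure ℂ)).real (graphCross K B₀ B₂ δ)|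
      ≤ (lawBW (volume : Measure ℂ)).real {c : PointConfig ℂ × PointConfig ℂ | c.1 ∈ E} := h1
    _ = (poissonLaw (volume : Measure ℂ)).real E := rl_lawBW_real_fst E
    _ ≤ (36 * ρ₀ / d₀ + 13) ^ 2 * Real.exp (-(Real.pi * (d₀ / 9 * δ⁻¹) ^ 2)) := hE_le

/-! ### The stub -/

/-- **Locality of the homogeneous graph crossing event under restriction** (brick of the S3b
re-cut; Benjamini–Schramm 1998 §2 cluster event with the no-giant-cells Lemma 5.5,
Bollobás–Riordan 2006 Ch. 8): for a compact `K'` inside an open `W` and carrier families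
`K δ ⊆ K'`, restricting both colours of the homogeneous two-colour Poisson nuclei to
`{b | δ b ∈ W}` changes the probability of `graphCross (K δ) (B₀ δ) (B₂ δ) δ` by `o(1)` as
`δ → 0⁺` (in fact by `O(exp (-c/δ²))`). -/
theorem stub_graphRestrict : Sig.stub_graphRestrict := by
  intro K' W hK' hW hK'W K B₀ B₂ hKK'
  obtain ⟨d₀, hd₀, hthick⟩ := hK'.exists_thickening_subset_open hW hK'W
  obtain ⟨r, hr0, hr⟩ := hK'.isBounded.subset_closedBall_lt 0 (0 : ℂ)
  set C : ℝ := (36 * r / d₀ + 13) ^ 2 with hC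
  refine squeeze_zero_norm' (a := fun δ : ℝ => C * Real.exp (-(Real.pi * (d₀ / 9 * δ⁻¹) ^ 2)))
    ?_ ?_
  · filter_upwards [self_mem_nhdsWithin] with δ hδ
    rw [Real.norm_eq_abs]
    exact gr_abs_sub_le hd₀ hr0.le hδ (hKK' δ) hthick hr
  · have h1 : Tendsto (fun δ : ℝ => d₀ / 9 * δ⁻¹) (𝓝[>] 0) atTop :=
      tendsto_inv_nhdsGT_zero.const_mul_atTop (by positivity)
    have h2 : Tendsto (fun δ : ℝ => Real.pi * (d₀ / 9 * δ⁻¹) ^ 2) (𝓝[>] 0) atTop :=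
      ((tendsto_pow_atTop two_ne_zero).comp h1).const_mul_atTop Real.pi_pos
    have h3 := (Real.tendsto_exp_neg_atTop_nhds_zero.comp h2).const_mul C
    rw [mul_zero] at h3
    exact h3

end Summit.CriticalPhenomena.CardyFormulaZ2.Cruxes.VoronoiHubFromSmirnov.MoebiusExactDelaunayDilationWard

end
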